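import Literature.Analysis.InverseSpectral.HelicalFunction
import HarnessLib

/-!
# Kreĭn's representation theorem for helical functions: the integrand and the easy direction

First file of the proof of the named fact
`Literature.Analysis.InverseSpectral.KreinHelicalRepresentation` (Arov–Dym 2012, Thm 9.1, scalar
case). Here:

* API for the integrand `h(t, x) = (e^{-ixt} - 1 + ixt/(1+x²))/x²` (`kreinHelicalIntegrand`): the
  Taylor-remainder form `h(t, x) = -∫₀ᵗ (t - u) e^{-ixu} du - ixt/(1+x²)` valid for *all* `x`
  (including the value `-t²/2` at `x = 0`), whence continuity in `x`, measurability, the bound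
  `‖h(t, x)‖ ≤ (2t² + 2|t| + 4)/(1 + x²)`, conjugation symmetry `conj h(t,x) = h(-t,x)` and the
  factorisation of its kernel `h(t-s,x) - h(t,x) - h(-s,x) + h(0,x) = φ(t,x) conj φ(s,x)`;
* integrability against a measure `σ` with `∫ dσ/(1+x²) < ∞`, continuity and Hermitian symmetry of
  Kreĭn's formula `kreinHelicalRep α β σ`;
* the zero-sum reduction of the kernel form `∑ conj ξᵢ k_g(tᵢ,tⱼ) ξⱼ`;
* the **easy direction** of Thm 9.1: every function given by Kreĭn's formula (9.4) with data
  (9.5) is helical on `ℝ` (`IsKreinHelicalMeasure.isHelical_kreinHelicalRep`), and a function that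
  agrees with such a formula on `[-a, a]` is helical on `[-a, a]`
  (`IsKreinHelicalMeasure.isHelicalOn_of_eqOn`).

The hard direction (existence of the representation) is proved in the sibling files
`HelicalFunctionProofsToeplitz`, `HelicalFunctionProofsLimit`, `HelicalFunctionProofs` by
discretisation (Carathéodory–Toeplitz extension, Fejér approximants, Prokhorov compactness).

## References

* D. Z. Arov, H. Dym, *Bitangential direct and inverse problems for systems of integral and
  differential equations*, CUP 2012, §9.1, Theorem 9.1 (formulas (9.2), (9.4), (9.5)).
-/

open MeasureTheory Set Complex Filter Finset
open scoped ComplexOrder ComplexConjugate ENNReal Topology BigOperators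

noncomputable section

namespace Literature.Analysis.InverseSpectral

/-! ### Elementary facts about the integrand -/

/-- Off the origin the integrand is the printed formula. [cite: ArovDym2012, Thm 9.1 (9.4)] -/
lemma kreinHelicalIntegrand_of_ne_zero (t : ℝ) {x : ℝ} (hx : x ≠ 0) :
    kreinHelicalIntegrand t x =
      (cexp (-(I * x * t)) - 1 + I * x * t / (1 + (x : ℂ) ^ 2)) / (x : ℂ) ^ 2 := by
  simp [kreinHelicalIntegrand, hx]

/-- `h(0, x) = 0`. [folklore] -/
@[simp] lemma kreinHelicalIntegrand_zero_left (x : ℝ) : kreinHelicalIntegrand 0 x = 0 := by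
  by_cases hx : x = 0
  · simp [kreinHelicalIntegrand, hx]
  · simp [kreinHelicalIntegrand, hx]

/-- `1 + x² ≠ 0` in `ℂ` for real `x`. [folklore] -/
lemma one_add_sq_ne_zero (x : ℝ) : (1 + (x : ℂ) ^ 2) ≠ 0 := by
  have h : (1 + (x : ℂ) ^ 2) = ((1 + x ^ 2 : ℝ) : ℂ) := by push_cast; ring
  rw [h, Ne, Complex.ofReal_eq_zero]
  positivity

/-- Continuity of the integrand in the time variable `t`. [folklore] -/
lemma continuous_kreinHelicalIntegrand_left (x : ℝ) :
    Continuous fun t => kreinHelicalIntegrand t x := by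
  by_cases hx : x = 0
  · subst hx
    simp only [kreinHelicalIntegrand_zero]
    fun_prop
  · simp only [kreinHelicalIntegrand, hx, if_false]
    have h1 := one_add_sq_ne_zero x
    fun_prop (disch := assumption)

/-- Measurability of the integrand in the frequency variable. [folklore] -/
lemma measurable_kreinHelicalIntegrand (t : ℝ) : Measurable (kreinHelicalIntegrand t) := by
  unfold kreinHelicalIntegrand
  refine Measurable.ite (measurableSet_singleton 0) measurable_const ?_
  fun_prop

/-- Conjugation symmetry `conj h(t, x) = h(-t, x)`. [folklore] -/
lemma conj_kreinHelicalIntegrand (t x : ℝ) :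
    conj (kreinHelicalIntegrand t x) = kreinHelicalIntegrand (-t) x := by
  by_cases hx : x = 0
  · subst hx
    simp [kreinHelicalIntegrand, Complex.conj_ofReal, map_ofNat]
  · rw [kreinHelicalIntegrand_of_ne_zero t hx, kreinHelicalIntegrand_of_ne_zero (-t) hx]
    simp only [map_div₀, map_add, map_sub, map_one, map_mul, map_pow, Complex.conj_ofReal,
      Complex.conj_I, ← Complex.exp_conj, map_neg, Complex.ofReal_neg]
    ring_nf

/-! ### The Taylor-remainder form and continuity in the frequency variable -/

/-- The Taylor remainder `∫₀ᵗ (t-u) e^{-ixu} du`, for `x ≠ 0`, in closed form: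
`-x² ∫₀ᵗ (t-u) e^{-ixu} du = e^{-ixt} - 1 + ixt`. [folklore] -/
lemma integral_taylor_cexp (t : ℝ) {x : ℝ} (hx : x ≠ 0) :
    ∫ u in (0 : ℝ)..t, ((t : ℂ) - u) * cexp (-(I * x * u)) =
      -(cexp (-(I * x * t)) - 1 + I * x * t) / (x : ℂ) ^ 2 := by
  have hx' : (x : ℂ) ≠ 0 := Complex.ofReal_ne_zero.2 hx
  have hx2 : (x : ℂ) ^ 2 ≠ 0 := pow_ne_zero 2 hx'
  -- antiderivative `Φ u = e^{-ixu} (ix(t - u) - 1) / x²`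
  have hderiv : ∀ u : ℝ, HasDerivAt (fun u : ℝ => cexp (-(I * x * u)) * (I * x * ((t : ℂ) - u) - 1) /
      (x : ℂ) ^ 2) (((t : ℂ) - u) * cexp (-(I * x * u))) u := by
    intro u
    have hid : HasDerivAt (fun u : ℝ => (u : ℂ)) 1 u := by
      simpa using (hasDerivAt_id u).ofReal_comp
    have h1 : HasDerivAt (fun u : ℝ => -(I * x * (u : ℂ))) (-(I * x * 1)) u :=
      (hid.const_mul (I * x)).neg
    have he : HasDerivAt (fun u : ℝ => cexp (-(I * x * (u : ℂ)))) (cexp (-(I * x * u)) * (-(I * x * 1))) u :=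
      h1.cexp
    have hl : HasDerivAt (fun u : ℝ => I * x * ((t : ℂ) - u) - 1) (I * x * (-1)) u :=
      ((hid.const_sub (t : ℂ)).const_mul (I * x)).sub_const 1
    have h := (he.mul hl).div_const ((x : ℂ) ^ 2)
    refine h.congr_deriv ?_
    rw [div_eq_iff hx2]
    linear_combination (-(cexp (-(I * x * u))) * (x : ℂ) ^ 2 * ((t : ℂ) - u)) * Complex.I_mul_I
  have hcont : Continuous fun u : ℝ => ((t : ℂ) - u) * cexp (-(I * x * u)) := by fun_prop
  rw [intervalIntegral.integral_eq_sub_of_hasDerivAt (fun u _ => hderiv u) (hcont.intervalIntegrable 0 t)]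
  simp only [sub_self, mul_zero, zero_sub, Complex.ofReal_zero, neg_zero, Complex.exp_zero, one_mul]
  ring

/-- **Taylor-remainder form of the integrand**, valid for every `x` (at `x = 0` both sides are
`-t²/2`): `h(t, x) = -∫₀ᵗ (t-u) e^{-ixu} du - ixt/(1+x²)`. [folklore] -/
lemma kreinHelicalIntegrand_eq_integral (t x : ℝ) :
    kreinHelicalIntegrand t x =
      -(∫ u in (0 : ℝ)..t, ((t : ℂ) - u) * cexp (-(I * x * u))) - I * x * t / (1 + (x : ℂ) ^ 2) := by
  by_cases hx : x = 0
  · subst hx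
    simp only [kreinHelicalIntegrand_zero, Complex.ofReal_zero, mul_zero, zero_mul, neg_zero,
      Complex.exp_zero, mul_one, zero_div, sub_zero]
    have hint : (fun u : ℝ => ((t : ℂ) - u)) = fun u : ℝ => ((t - u : ℝ) : ℂ) := by
      funext u; push_cast; ring
    rw [hint, intervalIntegral.integral_ofReal,
      intervalIntegral.integral_sub (f := fun _ : ℝ => t) (g := fun u : ℝ => u) intervalIntegrable_const
        (continuous_id.intervalIntegrable _ _),
      intervalIntegral.integral_const, integral_id]
    simp only [sub_zero, smul_eq_mul]
    push_cast
    ring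
  · rw [kreinHelicalIntegrand_of_ne_zero t hx, integral_taylor_cexp t hx]
    have hx' : (x : ℂ) ≠ 0 := Complex.ofReal_ne_zero.2 hx
    have h1 := one_add_sq_ne_zero x
    field_simp
    ring

/-- Continuity of the integrand in the frequency variable `x`, across `x = 0`. [folklore] -/
lemma continuous_kreinHelicalIntegrand_right (t : ℝ) : Continuous (kreinHelicalIntegrand t) := by
  have h : kreinHelicalIntegrand t = fun x : ℝ =>
      -(∫ u in (0 : ℝ)..t, ((t : ℂ) - u) * cexp (-(I * x * u))) - I * x * t / (1 + (x : ℂ) ^ 2) :=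
    funext fun x => kreinHelicalIntegrand_eq_integral t x
  rw [h]
  refine Continuous.sub (Continuous.neg ?_) ?_
  · exact intervalIntegral.continuous_parametric_intervalIntegral_of_continuous (by fun_prop)
      continuous_const
  · refine Continuous.div (by fun_prop) (by fun_prop) fun x => one_add_sq_ne_zero x

/-! ### Bounds -/

/-- `‖∫₀ᵗ (t-u) e^{-ixu} du‖ ≤ t²`. [folklore] -/
lemma norm_integral_taylor_cexp_le (t x : ℝ) :
    ‖∫ u in (0 : ℝ)..t, ((t : ℂ) - u) * cexp (-(I * x * u))‖ ≤ t ^ 2 := by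
  have h : ∀ u ∈ Set.uIoc (0 : ℝ) t, ‖((t : ℂ) - u) * cexp (-(I * x * u))‖ ≤ |t| := by
    intro u hu
    rw [norm_mul]
    have he : ‖cexp (-(I * x * u))‖ = 1 := by
      have : -(I * x * u) = ((-(x * u) : ℝ) : ℂ) * I := by push_cast; ring
      rw [this, Complex.norm_exp_ofReal_mul_I]
    rw [he, mul_one]
    have hsub : ((t : ℂ) - u) = ((t - u : ℝ) : ℂ) := by push_cast; ring
    rw [hsub, Complex.norm_real, Real.norm_eq_abs]
    rcases Set.mem_uIoc.1 hu with ⟨h1, h2⟩ | ⟨h1, h2⟩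
    · rw [abs_of_nonneg (by linarith), abs_of_nonneg (by linarith)]; linarith
    · rw [abs_of_nonpos (by linarith), abs_of_nonpos (by linarith)]; linarith
  calc ‖∫ u in (0 : ℝ)..t, ((t : ℂ) - u) * cexp (-(I * x * u))‖ ≤ |t| * |t - 0| :=
        intervalIntegral.norm_integral_le_of_norm_le_const h
    _ = t ^ 2 := by rw [sub_zero, ← abs_mul, abs_mul_self, sq]

/-- `|x| / (1 + x²) ≤ 1`. [folklore] -/
lemma abs_div_one_add_sq_le_one (x : ℝ) : |x| / (1 + x ^ 2) ≤ 1 := by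
  rw [div_le_one (by positivity)]
  nlinarith [abs_nonneg x, sq_abs x, sq_nonneg (|x| - 1)]

/-- `‖ixt/(1+x²)‖ ≤ |t|`. [folklore] -/
lemma norm_compensator_le (t x : ℝ) : ‖I * x * t / (1 + (x : ℂ) ^ 2)‖ ≤ |t| := by
  have h : (1 + (x : ℂ) ^ 2) = ((1 + x ^ 2 : ℝ) : ℂ) := by push_cast; ring
  rw [h, norm_div, Complex.norm_real, norm_mul, norm_mul, Complex.norm_I, one_mul,
    Complex.norm_real, Complex.norm_real, Real.norm_eq_abs, Real.norm_eq_abs, Real.norm_eq_abs,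
    abs_of_pos (by positivity : (0 : ℝ) < 1 + x ^ 2)]
  calc |x| * |t| / (1 + x ^ 2) = |x| / (1 + x ^ 2) * |t| := by ring
    _ ≤ 1 * |t| := by gcongr; exact abs_div_one_add_sq_le_one x
    _ = |t| := one_mul _

/-- The crude bound `‖h(t, x)‖ ≤ t² + |t|`, valid for all `x`. [folklore] -/
lemma norm_kreinHelicalIntegrand_le_sq_add_abs (t x : ℝ) :
    ‖kreinHelicalIntegrand t x‖ ≤ t ^ 2 + |t| := by
  rw [kreinHelicalIntegrand_eq_integral]
  refine (norm_sub_le _ _).trans (add_le_add ?_ (norm_compensator_le t x))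
  rw [norm_neg]
  exact norm_integral_taylor_cexp_le t x

/-- The tail bound `‖h(t, x)‖ ≤ (2 + |t|)/x²` for `x ≠ 0`. [folklore] -/
lemma norm_kreinHelicalIntegrand_le_div_sq (t : ℝ) {x : ℝ} (hx : x ≠ 0) :
    ‖kreinHelicalIntegrand t x‖ ≤ (2 + |t|) / x ^ 2 := by
  rw [kreinHelicalIntegrand_of_ne_zero t hx, norm_div, norm_pow, Complex.norm_real,
    Real.norm_eq_abs, sq_abs]
  gcongr
  refine (norm_add_le _ _).trans (add_le_add ((norm_sub_le _ _).trans ?_) (norm_compensator_le t x))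
  have he : ‖cexp (-(I * x * t))‖ = 1 := by
    have : -(I * x * t) = ((-(x * t) : ℝ) : ℂ) * I := by push_cast; ring
    rw [this, Complex.norm_exp_ofReal_mul_I]
  rw [he, norm_one]
  norm_num

/-- The constant `2t² + 2|t| + 4` of the global bound is monotone in `|t|`. [folklore] -/
lemma kreinBound_mono {t s : ℝ} (h : |t| ≤ |s|) :
    2 * t ^ 2 + 2 * |t| + 4 ≤ 2 * s ^ 2 + 2 * |s| + 4 := by
  have : t ^ 2 ≤ s ^ 2 := by rw [← sq_abs t, ← sq_abs s]; gcongr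
  linarith

/-- **Global bound** `‖h(t, x)‖ ≤ (2t² + 2|t| + 4)/(1 + x²)`. [folklore] -/
lemma norm_kreinHelicalIntegrand_le (t x : ℝ) :
    ‖kreinHelicalIntegrand t x‖ ≤ (2 * t ^ 2 + 2 * |t| + 4) / (1 + x ^ 2) := by
  rw [le_div_iff₀ (by positivity)]
  by_cases hx : |x| ≤ 1
  · have hx2 : x ^ 2 ≤ 1 := by rw [← sq_abs]; nlinarith [abs_nonneg x]
    have h := norm_kreinHelicalIntegrand_le_sq_add_abs t x
    have hn := norm_nonneg (kreinHelicalIntegrand t x)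
    nlinarith [abs_nonneg t, sq_nonneg t]
  · rw [not_le] at hx
    have hx0 : x ≠ 0 := by rintro rfl; norm_num at hx
    have hx2 : 1 ≤ x ^ 2 := by rw [← sq_abs]; nlinarith
    have h := norm_kreinHelicalIntegrand_le_div_sq t hx0
    rw [le_div_iff₀ (by positivity)] at h
    have hn := norm_nonneg (kreinHelicalIntegrand t x)
    nlinarith [abs_nonneg t, sq_nonneg t]

/-! ### Integrability, continuity and symmetry of Kreĭn's formula -/

/-- Under (9.5), `x ↦ (1 + x²)⁻¹` is `σ`-integrable. [folklore] -/
lemma IsKreinHelicalMeasure.integrable_inv_one_add_sq {σ : Measure ℝ} (hσ : IsKreinHelicalMeasure σ) :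
    Integrable (fun x : ℝ => (1 + x ^ 2)⁻¹) σ := by
  refine ⟨by fun_prop, ?_⟩
  rw [hasFiniteIntegral_iff_ofReal (Eventually.of_forall fun x => by positivity)]
  exact hσ

/-- Under (9.5), the integrand `h(t, ·)` is `σ`-integrable for every `t`. [folklore] -/
lemma IsKreinHelicalMeasure.integrable_kreinHelicalIntegrand {σ : Measure ℝ}
    (hσ : IsKreinHelicalMeasure σ) (t : ℝ) : Integrable (kreinHelicalIntegrand t) σ := by
  refine (hσ.integrable_inv_one_add_sq.const_mul (2 * t ^ 2 + 2 * |t| + 4)).mono'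
    (measurable_kreinHelicalIntegrand t).aestronglyMeasurable (Eventually.of_forall fun x => ?_)
  rw [← div_eq_mul_inv]
  exact norm_kreinHelicalIntegrand_le t x

/-- Continuity of `t ↦ ∫ h(t, x) dσ(x)` under (9.5) (dominated convergence on balls).
[folklore] -/
lemma IsKreinHelicalMeasure.continuous_integral {σ : Measure ℝ} (hσ : IsKreinHelicalMeasure σ) :
    Continuous fun t : ℝ => ∫ x, kreinHelicalIntegrand t x ∂σ := by
  refine continuous_iff_continuousAt.2 fun t₀ => ?_
  refine continuousAt_of_dominated
    (bound := fun x => (2 * (|t₀| + 1) ^ 2 + 2 * |(|t₀| + 1)| + 4) * (1 + x ^ 2)⁻¹)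
    (Eventually.of_forall fun t => (measurable_kreinHelicalIntegrand t).aestronglyMeasurable) ?_
    (hσ.integrable_inv_one_add_sq.const_mul _)
    (Eventually.of_forall fun x => (continuous_kreinHelicalIntegrand_left x).continuousAt)
  have hball : ∀ᶠ t in 𝓝 t₀, |t| ≤ |t₀| + 1 := by
    have : Metric.ball t₀ 1 ∈ 𝓝 t₀ := Metric.ball_mem_nhds t₀ one_pos
    filter_upwards [this] with t ht
    rw [Metric.mem_ball, Real.dist_eq] at ht
    have := abs_sub_abs_le_abs_sub t t₀
    linarith
  filter_upwards [hball] with t ht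
  refine Eventually.of_forall fun x => (norm_kreinHelicalIntegrand_le t x).trans ?_
  rw [div_eq_mul_inv]
  exact mul_le_mul_of_nonneg_right (kreinBound_mono (ht.trans (le_abs_self _))) (by positivity)

/-- Continuity of Kreĭn's formula `kreinHelicalRep α β σ` under (9.5). [folklore] -/
lemma IsKreinHelicalMeasure.continuous_kreinHelicalRep {σ : Measure ℝ} (hσ : IsKreinHelicalMeasure σ)
    (α β : ℝ) : Continuous (kreinHelicalRep α β σ) := by
  unfold kreinHelicalRep
  have := hσ.continuous_integral
  fun_prop

/-- Hermitian symmetry of Kreĭn's formula: `G(-t) = conj (G t)` (for any measure).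
[folklore] -/
lemma kreinHelicalRep_neg (α β : ℝ) (σ : Measure ℝ) (t : ℝ) :
    kreinHelicalRep α β σ (-t) = conj (kreinHelicalRep α β σ t) := by
  unfold kreinHelicalRep
  simp only [map_add, map_neg, map_mul, Complex.conj_ofReal, Complex.conj_I, map_div₀, map_one,
    ← integral_conj, conj_kreinHelicalIntegrand, Complex.ofReal_neg]
  ring

/-- `G(0) = -β`. [folklore] -/
@[simp] lemma kreinHelicalRep_zero (α β : ℝ) (σ : Measure ℝ) : kreinHelicalRep α β σ 0 = -β := by
  simp [kreinHelicalRep]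

/-! ### The kernel of the integrand factorises -/

/-- **Kernel factorisation**: `h(t-s,x) - h(t,x) - h(-s,x) + h(0,x) = φ(t,x) conj φ(s,x)` with
`φ(t, x) = (e^{-ixt} - 1)/x` (`x ≠ 0`), `φ(t, 0) = t`. [folklore] -/
lemma helicalKernel_kreinHelicalIntegrand (x t s : ℝ) :
    helicalKernel (fun u => kreinHelicalIntegrand u x) t s =
      (if x = 0 then (t : ℂ) else (cexp (-(I * x * t)) - 1) / x) *
        conj (if x = 0 then (s : ℂ) else (cexp (-(I * x * s)) - 1) / x) := by
  simp only [helicalKernel, kreinHelicalIntegrand_zero_left, add_zero]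
  by_cases hx : x = 0
  · subst hx
    simp only [kreinHelicalIntegrand_zero, if_true, Complex.conj_ofReal]
    push_cast
    ring
  · simp only [hx, if_false]
    rw [kreinHelicalIntegrand_of_ne_zero _ hx, kreinHelicalIntegrand_of_ne_zero _ hx,
      kreinHelicalIntegrand_of_ne_zero _ hx]
    have hx' : (x : ℂ) ≠ 0 := Complex.ofReal_ne_zero.2 hx
    have h1 := one_add_sq_ne_zero x
    simp only [map_div₀, map_sub, map_one, Complex.conj_ofReal, ← Complex.exp_conj, map_neg,
      map_mul, Complex.conj_I]
    have hts : cexp (-(I * x * ((t - s : ℝ) : ℂ))) = cexp (-(I * x * t)) * cexp (-(-I * x * s)) := by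
      rw [← Complex.exp_add]; push_cast; ring_nf
    rw [hts]
    field_simp
    push_cast
    ring

/-- A double sum `∑ᵢⱼ conj ξᵢ (aᵢ conj aⱼ) ξⱼ` is `|∑ⱼ ξⱼ conj aⱼ|²`. [folklore] -/
lemma sum_sum_conj_mul_mul_conj_mul {n : ℕ} (ξ a : Fin n → ℂ) :
    ∑ i, ∑ j, conj (ξ i) * (a i * conj (a j)) * ξ j =
      ((Complex.normSq (∑ j, ξ j * conj (a j)) : ℝ) : ℂ) := by
  rw [← Complex.mul_conj, map_sum, Finset.sum_mul_sum, Finset.sum_comm]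
  refine Finset.sum_congr rfl fun i _ => Finset.sum_congr rfl fun j _ => ?_
  simp only [map_mul, Complex.conj_conj]
  ring

/-! ### Zero-sum reduction of the kernel form -/

/-- For zero-sum coefficients the kernel form reduces to the difference form:
`∑ conj ξᵢ k_g(tᵢ,tⱼ) ξⱼ = ∑ conj ξᵢ g(tᵢ - tⱼ) ξⱼ` when `∑ ξᵢ = 0`. [folklore] -/
theorem sum_helicalKernel_eq_of_sum_eq_zero (g : ℝ → ℂ) {n : ℕ} (t : Fin n → ℝ) (ξ : Fin n → ℂ)
    (hξ : ∑ i, ξ i = 0) :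
    ∑ i, ∑ j, conj (ξ i) * helicalKernel g (t i) (t j) * ξ j =
      ∑ i, ∑ j, conj (ξ i) * g (t i - t j) * ξ j := by
  have hξ' : ∑ i, conj (ξ i) = 0 := by rw [← map_sum, hξ, map_zero]
  have h1 : ∑ i, ∑ j, conj (ξ i) * g (t i) * ξ j = 0 := by
    simp_rw [← Finset.mul_sum, hξ, mul_zero, Finset.sum_const_zero]
  have h2 : ∑ i, ∑ j, conj (ξ i) * g (-t j) * ξ j = 0 := by
    rw [Finset.sum_comm]
    simp_rw [mul_assoc, ← Finset.sum_mul, hξ', zero_mul, Finset.sum_const_zero]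
  have h3 : ∑ i, ∑ j, conj (ξ i) * g 0 * ξ j = 0 := by
    simp_rw [← Finset.mul_sum, hξ, mul_zero, Finset.sum_const_zero]
  have : ∀ i j, conj (ξ i) * helicalKernel g (t i) (t j) * ξ j =
      conj (ξ i) * g (t i - t j) * ξ j - conj (ξ i) * g (t i) * ξ j -
        conj (ξ i) * g (-t j) * ξ j + conj (ξ i) * g 0 * ξ j := by
    intro i j; unfold helicalKernel; ring
  simp_rw [this, Finset.sum_add_distrib, Finset.sum_sub_distrib, h1, h2, h3]
  ring

/-! ### The easy direction of Kreĭn's theorem -/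

section Easy

variable {σ : Measure ℝ}

/-- The kernel of Kreĭn's formula is the `σ`-integral of the kernels of the integrand (the affine
part `-β + iαt` has zero kernel). [folklore] -/
lemma helicalKernel_kreinHelicalRep (hσ : IsKreinHelicalMeasure σ) (α β : ℝ) (t s : ℝ) :
    helicalKernel (kreinHelicalRep α β σ) t s =
      (1 / Real.pi : ℂ) * ∫ x, (if x = 0 then (t : ℂ) else (cexp (-(I * x * t)) - 1) / x) *
        conj (if x = 0 then (s : ℂ) else (cexp (-(I * x * s)) - 1) / x) ∂σ := by
  simp_rw [← helicalKernel_kreinHelicalIntegrand]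
  unfold helicalKernel kreinHelicalRep
  rw [integral_add, integral_sub, integral_sub]
  · simp only [kreinHelicalIntegrand_zero_left, integral_zero]
    push_cast
    ring
  · exact hσ.integrable_kreinHelicalIntegrand _
  · exact hσ.integrable_kreinHelicalIntegrand _
  · exact (hσ.integrable_kreinHelicalIntegrand _).sub (hσ.integrable_kreinHelicalIntegrand _)
  · exact hσ.integrable_kreinHelicalIntegrand _
  · exact ((hσ.integrable_kreinHelicalIntegrand _).sub (hσ.integrable_kreinHelicalIntegrand _)).sub
      (hσ.integrable_kreinHelicalIntegrand _)
  · simp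

/-- Integrability of the kernel of the integrand. [folklore] -/
lemma integrable_kreinFactor_mul_conj (hσ : IsKreinHelicalMeasure σ) (t s : ℝ) :
    Integrable (fun x : ℝ => (if x = 0 then (t : ℂ) else (cexp (-(I * x * t)) - 1) / x) *
        conj (if x = 0 then (s : ℂ) else (cexp (-(I * x * s)) - 1) / x)) σ := by
  have h : (fun x : ℝ => (if x = 0 then (t : ℂ) else (cexp (-(I * x * t)) - 1) / x) *
        conj (if x = 0 then (s : ℂ) else (cexp (-(I * x * s)) - 1) / x)) =
      fun x => kreinHelicalIntegrand (t - s) x - kreinHelicalIntegrand t x -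
        kreinHelicalIntegrand (-s) x + kreinHelicalIntegrand 0 x := by
    funext x
    rw [← helicalKernel_kreinHelicalIntegrand]
    rfl
  rw [h]
  exact (((hσ.integrable_kreinHelicalIntegrand _).sub (hσ.integrable_kreinHelicalIntegrand _)).sub
    (hσ.integrable_kreinHelicalIntegrand _)).add (hσ.integrable_kreinHelicalIntegrand _)

/-- **The kernel of Kreĭn's formula is positive semidefinite** on all of `ℝ`:
`∑ conj ξᵢ k_G(tᵢ,tⱼ) ξⱼ = (1/π) ∫ |∑ⱼ ξⱼ conj φ(tⱼ,x)|² dσ(x) ≥ 0`.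
[cite: ArovDym2012, Thm 9.1] -/
theorem sum_helicalKernel_kreinHelicalRep_nonneg (hσ : IsKreinHelicalMeasure σ) (α β : ℝ) {n : ℕ}
    (t : Fin n → ℝ) (ξ : Fin n → ℂ) :
    0 ≤ ∑ i, ∑ j, conj (ξ i) * helicalKernel (kreinHelicalRep α β σ) (t i) (t j) * ξ j := by
  -- abbreviate the factor `φ`
  set φ : ℝ → ℝ → ℂ := fun u x => if x = 0 then (u : ℂ) else (cexp (-(I * x * u)) - 1) / x with hφ
  have hker : ∀ i j, helicalKernel (kreinHelicalRep α β σ) (t i) (t j) =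
      (1 / Real.pi : ℂ) * ∫ x, φ (t i) x * conj (φ (t j) x) ∂σ := fun i j =>
    helicalKernel_kreinHelicalRep hσ α β (t i) (t j)
  simp_rw [hker]
  have hint : ∀ i j, Integrable (fun x => φ (t i) x * conj (φ (t j) x)) σ :=
    fun i j => integrable_kreinFactor_mul_conj hσ _ _
  have h1 : ∀ i j, conj (ξ i) * ((1 / Real.pi : ℂ) * ∫ x, φ (t i) x *
      conj (φ (t j) x) ∂σ) * ξ j = (1 / Real.pi : ℂ) *
        ∫ x, conj (ξ i) * (φ (t i) x * conj (φ (t j) x)) * ξ j ∂σ := by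
    intro i j
    rw [integral_mul_const, integral_const_mul]
    ring
  simp_rw [h1, ← Finset.mul_sum]
  have h2 : ∑ i, ∑ j, ∫ x, conj (ξ i) * (φ (t i) x * conj (φ (t j) x)) * ξ j ∂σ =
      ∫ x, ∑ i, ∑ j, conj (ξ i) * (φ (t i) x * conj (φ (t j) x)) * ξ j ∂σ := by
    have hij : ∀ i j, Integrable
        (fun x => conj (ξ i) * (φ (t i) x * conj (φ (t j) x)) * ξ j) σ :=
      fun i j => ((hint i j).const_mul _).mul_const _
    rw [integral_finsetSum _ fun i _ => integrable_finsetSum _ fun j _ => hij i j]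
    exact Finset.sum_congr rfl fun i _ => (integral_finsetSum _ fun j _ => hij i j).symm
  rw [h2]
  simp_rw [sum_sum_conj_mul_mul_conj_mul]
  rw [integral_complex_ofReal]
  have h3 : (1 / Real.pi : ℂ) * ((∫ x, Complex.normSq (∑ j, ξ j * conj (φ (t j) x)) ∂σ : ℝ) : ℂ)
      = (((1 / Real.pi) * ∫ x, Complex.normSq (∑ j, ξ j * conj (φ (t j) x)) ∂σ : ℝ) : ℂ) := by
    push_cast; ring
  rw [h3, Complex.zero_le_real]
  exact mul_nonneg (by positivity) (integral_nonneg fun x => Complex.normSq_nonneg _)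

/-- **Easy direction of Kreĭn's theorem, case `a = ∞`**: for any `α, β ∈ ℝ` and any measure
`σ` with `∫ dσ/(1+μ²) < ∞`, Kreĭn's formula (9.4) defines a helical function on `ℝ`.
[cite: ArovDym2012, Thm 9.1] -/
theorem IsKreinHelicalMeasure.isHelical_kreinHelicalRep (hσ : IsKreinHelicalMeasure σ) (α β : ℝ) :
    IsHelical (kreinHelicalRep α β σ) :=
  ⟨hσ.continuous_kreinHelicalRep α β, kreinHelicalRep_neg α β σ,
    fun _ t ξ _ => sum_helicalKernel_kreinHelicalRep_nonneg hσ α β t ξ⟩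

/-- **Easy direction of Kreĭn's theorem, case `0 < a < ∞`**: a function that agrees on `[-a, a]`
with Kreĭn's formula (9.4), data as in (9.5), is helical on `[-a, a]`.
[cite: ArovDym2012, Thm 9.1] -/
theorem IsKreinHelicalMeasure.isHelicalOn_of_eqOn (hσ : IsKreinHelicalMeasure σ) {α β a : ℝ}
    {g : ℝ → ℂ} (hg : ∀ t ∈ Set.Icc (-a) a, g t = kreinHelicalRep α β σ t) : IsHelicalOn a g := by
  have hG := hσ.isHelical_kreinHelicalRep α β
  refine ⟨(hG.1.continuousOn).congr fun t ht => hg t ht, fun t ht => ?_, fun n t ξ ht => ?_⟩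
  · have hnt : -t ∈ Set.Icc (-a) a := ⟨by linarith [ht.2], by linarith [ht.1]⟩
    rw [hg t ht, hg (-t) hnt, kreinHelicalRep_neg]
  · have hK : ∀ i j, helicalKernel g (t i) (t j) = helicalKernel (kreinHelicalRep α β σ) (t i) (t j) := by
      intro i j
      have hi := ht i
      have hj := ht j
      unfold helicalKernel
      have h4 : 0 ≤ a := hi.1.trans hi.2
      rw [hg (t i - t j) ⟨by linarith [hi.1, hj.2], by linarith [hi.2, hj.1]⟩,
        hg (t i) ⟨by linarith [hi.1], hi.2⟩,
        hg (-t j) ⟨by linarith [hj.2], by linarith [hj.1]⟩,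
        hg 0 ⟨by linarith, h4⟩]
    simp_rw [hK]
    exact hG.2.2 n t ξ fun i => (ht i).1

end Easy

end Literature.Analysis.InverseSpectral
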